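import Summits.AnomalousDissipation.AnomalousDissipation.Theorems.SawtoothPulseCascadeLipAgmonEnvelopeSeqP
import Summits.AnomalousDissipation.AnomalousDissipation.Theorems.SawtoothPulseCascadeApproxEnvelopeP
import Summits.AnomalousDissipation.AnomalousDissipation.Theorems.SawtoothPulseCascadeLipAgmonCascadeSlot
import Summits.AnomalousDissipation.AnomalousDissipation.Theorems.SawtoothPulseCascadeLipAgmonSizes
import Summits.AnomalousDissipation.AnomalousDissipation.Theorems.SawtoothPulseCascadeLipAgmonEnvelope
import Literature.Analysis.FunctionSpaces.TorusAgmonPlanar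

/-!
# The Lipschitz envelope of the linearised cascade response from `K2″` alone at `ρN = 2`, SYMBOLIC corner rounding `δ₀`
(route `AnomalousDissipation/SawtoothPulseCascade`; helper for the crux K1loc = stmt-AnomalousDissipation-19491,
δ₀-generalisation of the pointwise closure K1loc ∧ K2 → Target — ROUND-18 §D.2 of the K1loc arbiter)

`lipEnvelope_of_caps_P` is the landed `LipAgmon.lipEnvelope_two_of_caps` with the box point `⟨γ, 1/4, 2, 1, 2⟩`
replaced by `⟨γ, δ₀, 2, 1, 2⟩`, `0 < δ₀`: GIVEN the profile caps of the cascade on its half-slots (hypotheses `hcapH`,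
`hcapV`, discharged for every `P` by `caps_H` / `caps_V`), the per-phase cap `K2″` at `⟨γ, δ₀, 2, 1, 2⟩` yields a
continuous Lipschitz majorant `Λ` of the classical linearised response with `Λ(t) ≤ K ν (j+1) M₁^{j+1}` on phase `j`
up to the horizon and `M₁ < (γ²−3)²`.  The only changes: the `L²` envelope is `ApproxResponse.responseL2EnvelopeP`,
the half-slot scale is `N_j/δ_j = (1/δ₀)·4^j` (`ApproxResponse.pbox_N_div_δ`) and the phase bookkeeping is
`slot_envelopeP` at `s₀ = 1/δ₀`; the Lipschitz ratio `M₁ = √(R_Z R_V) < (γ²−3)²` (`ratio_lt_of_mem_Icc`) is δ₀-free.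
-/

set_option linter.dupNamespace false

noncomputable section

namespace Summit.AnomalousDissipation.AnomalousDissipation.Theorems.SawtoothPulseCascade.LipAgmon

open Set MeasureTheory
open scoped InnerProductSpace ContDiff
open Literature.Analysis Literature.Analysis.FunctionSpaces Literature.Analysis.FluidPDE
open Literature.Analysis.FluidPDE.Torus Literature.Analysis.FunctionSpaces.Torus
open Literature.Analysis.FluidPDE.SawtoothCascade Literature.Analysis.FluidPDE.SawtoothCascade.CascadeParams

set_option maxHeartbeats 1600000 in
/-- **S2″ modulo the profile caps at corner rounding `δ₀`: the Lipschitz envelope from `K2″` alone at `ρN = 2`.**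
For `γ ∈ [5,8]`, `0 < δ₀` and `P = ⟨γ, δ₀, 2, 1, 2⟩`, given the slot caps of the cascade profile (`hcapH`, `hcapV`), the
per-phase cap `K2″` at `P` gives `M₁ < (γ²−3)²`, `K ≥ 0` such that for every lag `A`, all small `ν`, every window `T'`
beyond the horizon and every classical response `(L, q)` there is a continuous `Λ` on `[0, T]` with
`‖DL(t)(x)‖ ≤ Λ(t) ≤ Kν(j+1)M₁^{j+1}` on phase `j`. [cite: MajdaBertozzi2002, §3.2 Prop. 3.7 (energy estimates for derivatives, uniform in the viscosity)] -/
theorem lipEnvelope_of_caps_P {γ : ℝ} (hγ : γ ∈ Icc (5 : ℝ) 8) {δ₀ : ℝ} (hδ₀ : 0 < δ₀) {c₃ c₄ c₅ : ℝ}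
    (hc₃ : 0 ≤ c₃)
    (hc₄ : 0 ≤ c₄) (hc₅ : 0 ≤ c₅)
    (hcapH : ∀ (ν : ℝ) (j : ℕ), ∀ t ∈ Icc (CascadeParams.tStart j) (CascadeParams.tStart j + CascadeParams.tHalf j),
      (∀ x (i m : Fin 2), |Torus.partialDeriv i (Torus.partialDeriv m
          (torusVorticityTensor ((⟨γ, δ₀, 2, 1, 2⟩ : CascadeParams).field t) 0 1)) x| ≤
        (⟨γ, δ₀, 2, 1, 2⟩ : CascadeParams).rateH j t *
          (c₃ * ((((⟨γ, δ₀, 2, 1, 2⟩ : CascadeParams).N j : ℕ) : ℝ) / (⟨γ, δ₀, 2, 1, 2⟩ : CascadeParams).δ j) ^ 2)) ∧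
      (∀ x (i l m : Fin 2), |Torus.partialDeriv i (Torus.partialDeriv l (Torus.partialDeriv m
          (torusVorticityTensor ((⟨γ, δ₀, 2, 1, 2⟩ : CascadeParams).field t) 0 1))) x| ≤
        (⟨γ, δ₀, 2, 1, 2⟩ : CascadeParams).rateH j t *
          (c₄ * ((((⟨γ, δ₀, 2, 1, 2⟩ : CascadeParams).N j : ℕ) : ℝ) / (⟨γ, δ₀, 2, 1, 2⟩ : CascadeParams).δ j) ^ 3)) ∧
      Real.sqrt (∫ x, (Torus.partialDeriv 0 (fun y => ν • Torus.laplacian ((⟨γ, δ₀, 2, 1, 2⟩ : CascadeParams).field t) y) x 1 -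
          Torus.partialDeriv 1 (fun y => ν • Torus.laplacian ((⟨γ, δ₀, 2, 1, 2⟩ : CascadeParams).field t) y) x 0) ^ 2) ≤
        (⟨γ, δ₀, 2, 1, 2⟩ : CascadeParams).rateH j t *
          (|ν| * c₃ * ((((⟨γ, δ₀, 2, 1, 2⟩ : CascadeParams).N j : ℕ) : ℝ) / (⟨γ, δ₀, 2, 1, 2⟩ : CascadeParams).δ j) ^ 2) ∧
      Real.sqrt (scalarGradNormSq (fun x =>
          Torus.partialDeriv 0 (fun y => ν • Torus.laplacian ((⟨γ, δ₀, 2, 1, 2⟩ : CascadeParams).field t) y) x 1 -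
          Torus.partialDeriv 1 (fun y => ν • Torus.laplacian ((⟨γ, δ₀, 2, 1, 2⟩ : CascadeParams).field t) y) x 0)) ≤
        (⟨γ, δ₀, 2, 1, 2⟩ : CascadeParams).rateH j t *
          (|ν| * c₄ * ((((⟨γ, δ₀, 2, 1, 2⟩ : CascadeParams).N j : ℕ) : ℝ) / (⟨γ, δ₀, 2, 1, 2⟩ : CascadeParams).δ j) ^ 3) ∧
      Real.sqrt (∑ i, ∑ m, ∫ x, (Torus.partialDeriv i (Torus.partialDeriv m (fun x =>
          Torus.partialDeriv 0 (fun y => ν • Torus.laplacian ((⟨γ, δ₀, 2, 1, 2⟩ : CascadeParams).field t) y) x 1 -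
          Torus.partialDeriv 1 (fun y => ν • Torus.laplacian ((⟨γ, δ₀, 2, 1, 2⟩ : CascadeParams).field t) y) x 0)) x) ^ 2) ≤
        (⟨γ, δ₀, 2, 1, 2⟩ : CascadeParams).rateH j t *
          (|ν| * c₅ * ((((⟨γ, δ₀, 2, 1, 2⟩ : CascadeParams).N j : ℕ) : ℝ) / (⟨γ, δ₀, 2, 1, 2⟩ : CascadeParams).δ j) ^ 4))
    (hcapV : ∀ (ν : ℝ) (j : ℕ), ∀ t ∈ Icc (CascadeParams.tStart j + CascadeParams.tHalf j) (CascadeParams.tStart (j + 1)),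
      (∀ x (i m : Fin 2), |Torus.partialDeriv i (Torus.partialDeriv m
          (torusVorticityTensor ((⟨γ, δ₀, 2, 1, 2⟩ : CascadeParams).field t) 0 1)) x| ≤
        (⟨γ, δ₀, 2, 1, 2⟩ : CascadeParams).rateV j t *
          (c₃ * ((((⟨γ, δ₀, 2, 1, 2⟩ : CascadeParams).N j : ℕ) : ℝ) / (⟨γ, δ₀, 2, 1, 2⟩ : CascadeParams).δ j) ^ 2)) ∧
      (∀ x (i l m : Fin 2), |Torus.partialDeriv i (Torus.partialDeriv l (Torus.partialDeriv m
          (torusVorticityTensor ((⟨γ, δ₀, 2, 1, 2⟩ : CascadeParams).field t) 0 1))) x| ≤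
        (⟨γ, δ₀, 2, 1, 2⟩ : CascadeParams).rateV j t *
          (c₄ * ((((⟨γ, δ₀, 2, 1, 2⟩ : CascadeParams).N j : ℕ) : ℝ) / (⟨γ, δ₀, 2, 1, 2⟩ : CascadeParams).δ j) ^ 3)) ∧
      Real.sqrt (∫ x, (Torus.partialDeriv 0 (fun y => ν • Torus.laplacian ((⟨γ, δ₀, 2, 1, 2⟩ : CascadeParams).field t) y) x 1 -
          Torus.partialDeriv 1 (fun y => ν • Torus.laplacian ((⟨γ, δ₀, 2, 1, 2⟩ : CascadeParams).field t) y) x 0) ^ 2) ≤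
        (⟨γ, δ₀, 2, 1, 2⟩ : CascadeParams).rateV j t *
          (|ν| * c₃ * ((((⟨γ, δ₀, 2, 1, 2⟩ : CascadeParams).N j : ℕ) : ℝ) / (⟨γ, δ₀, 2, 1, 2⟩ : CascadeParams).δ j) ^ 2) ∧
      Real.sqrt (scalarGradNormSq (fun x =>
          Torus.partialDeriv 0 (fun y => ν • Torus.laplacian ((⟨γ, δ₀, 2, 1, 2⟩ : CascadeParams).field t) y) x 1 -
          Torus.partialDeriv 1 (fun y => ν • Torus.laplacian ((⟨γ, δ₀, 2, 1, 2⟩ : CascadeParams).field t) y) x 0)) ≤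
        (⟨γ, δ₀, 2, 1, 2⟩ : CascadeParams).rateV j t *
          (|ν| * c₄ * ((((⟨γ, δ₀, 2, 1, 2⟩ : CascadeParams).N j : ℕ) : ℝ) / (⟨γ, δ₀, 2, 1, 2⟩ : CascadeParams).δ j) ^ 3) ∧
      Real.sqrt (∑ i, ∑ m, ∫ x, (Torus.partialDeriv i (Torus.partialDeriv m (fun x =>
          Torus.partialDeriv 0 (fun y => ν • Torus.laplacian ((⟨γ, δ₀, 2, 1, 2⟩ : CascadeParams).field t) y) x 1 -
          Torus.partialDeriv 1 (fun y => ν • Torus.laplacian ((⟨γ, δ₀, 2, 1, 2⟩ : CascadeParams).field t) y) x 0)) x) ^ 2) ≤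
        (⟨γ, δ₀, 2, 1, 2⟩ : CascadeParams).rateV j t *
          (|ν| * c₅ * ((((⟨γ, δ₀, 2, 1, 2⟩ : CascadeParams).N j : ℕ) : ℝ) / (⟨γ, δ₀, 2, 1, 2⟩ : CascadeParams).δ j) ^ 4))
    (hK2 : Literature.Analysis.FluidPDE.SawtoothCascade.K2PhaseGrowthClassical ⟨γ, δ₀, 2, 1, 2⟩ 3) :
    ∃ M₁ K : ℝ, 0 ≤ M₁ ∧ M₁ < (γ ^ 2 - 3) ^ 2 ∧ 0 ≤ K ∧
      ∀ A : ℕ, ∃ ν₀ : ℝ, 0 < ν₀ ∧ ∀ ν ∈ Set.Ioc 0 ν₀, ∀ T' : ℝ,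
        DriftFree.horizon (γ ^ 2 - 3) ν A < T' → T' < 1 →
        ∀ (L : ℝ → UnitAddTorus (Fin 2) → EuclideanSpace ℝ (Fin 2)) (q : ℝ → UnitAddTorus (Fin 2) → ℝ),
          Torus.IsSmoothSpaceTimeOn (Icc 0 T') L → Torus.IsSmoothSpaceTimeOn (Icc 0 T') q →
          (∀ t ∈ Icc 0 T', Torus.IsDivFree (L t)) → L 0 = 0 →
          (∀ t ∈ Icc 0 T', ∀ x, Torus.timeDerivWithin (Icc 0 T') L t x +
            Torus.convect ((⟨γ, δ₀, 2, 1, 2⟩ : CascadeParams).field t) (L t) x +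
            Torus.convect (L t) ((⟨γ, δ₀, 2, 1, 2⟩ : CascadeParams).field t) x =
              ν • Torus.laplacian (L t) x - Torus.gradient (q t) x +
                ν • Torus.laplacian ((⟨γ, δ₀, 2, 1, 2⟩ : CascadeParams).field t) x) →
          ∃ Λ : ℝ → ℝ,
            ContinuousOn Λ (Icc 0 (DriftFree.horizon (γ ^ 2 - 3) ν A)) ∧
            (∀ t ∈ Icc 0 (DriftFree.horizon (γ ^ 2 - 3) ν A), ∀ x : UnitAddTorus (Fin 2),
              ‖Torus.fderiv (L t) x‖ ≤ Λ t) ∧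
            ∀ j : ℕ, ∀ t ∈ Icc 0 (DriftFree.horizon (γ ^ 2 - 3) ν A),
              t ∈ Icc (CascadeParams.tStart j) (CascadeParams.tStart (j + 1)) →
              Λ t ≤ K * ν * ((j : ℝ) + 1) * M₁ ^ (j + 1) := by
  -- ### constants
  have hγ0 : (0 : ℝ) ≤ γ := le_trans (by norm_num) hγ.1
  have hγ1 : (1 : ℝ) ≤ γ := le_trans (by norm_num) hγ.1
  have hρN : (2 : ℕ) ∈ Finset.Icc 2 7 := Finset.mem_Icc.2 ⟨le_rfl, by norm_num⟩
  obtain ⟨M₂, K₂, hM₂0, hM₂r, hK₂0, H1⟩ := ApproxResponse.responseL2EnvelopeP hγ hδ₀ hρN hK2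
  obtain ⟨μ, hμ⟩ : ∃ μ : ℝ, μ = max M₂ 4 := ⟨_, rfl⟩
  have hμ4 : 4 ≤ μ := by rw [hμ]; exact le_max_right _ _
  have hM₂μ : M₂ ≤ μ := by rw [hμ]; exact le_max_left _ _
  have hμ0 : 0 ≤ μ := le_trans (by norm_num) hμ4
  have hμr : μ < γ ^ 2 - 3 := by rw [hμ]; exact max_lt hM₂r (by nlinarith [hγ.1])
  obtain ⟨CA, hCA0, hAg⟩ := Torus.exists_norm_sq_le_agmon_fin_two
  -- the phase-form constants
  obtain ⟨c₂, hc₂⟩ : ∃ c₂ : ℝ, c₂ = 2 * Real.sqrt (2 * Real.pi) := ⟨_, rfl⟩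
  have hc₂0 : 0 ≤ c₂ := by rw [hc₂]; positivity
  obtain ⟨C₂, hC₂⟩ : ∃ C₂ : ℝ, C₂ = 2 * c₂ := ⟨_, rfl⟩
  obtain ⟨C₃, hC₃⟩ : ∃ C₃ : ℝ, C₃ = (2 * Real.sqrt 2 * (2 + γ) + 4 * Real.sqrt 2 + 1) * c₃ := ⟨_, rfl⟩
  obtain ⟨C₄, hC₄⟩ : ∃ C₄ : ℝ, C₄ = (15 + γ) * c₄ + 2 * Real.sqrt 2 * c₂ * c₃ := ⟨_, rfl⟩
  obtain ⟨C₅, hC₅⟩ : ∃ C₅ : ℝ, C₅ = 4 * c₅ + c₂ * c₄ := ⟨_, rfl⟩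
  have hC₂0 : 0 ≤ C₂ := by rw [hC₂]; positivity
  have hC₃0 : 0 ≤ C₃ := by rw [hC₃]; positivity
  have hC₄0 : 0 ≤ C₄ := by rw [hC₄]; positivity
  have hC₅0 : 0 ≤ C₅ := by rw [hC₅]; positivity
  have hiδ : (0 : ℝ) ≤ 1 / δ₀ := by positivity
  obtain ⟨Bz, B₂, hBz0, hB₂0, hSE⟩ := slot_envelopeP (γ := γ) (K := K₂) (μ := μ) (C₂ := C₂) (C₃ := C₃)
    (C₄ := C₄) (C₅ := C₅) (s₀ := 1 / δ₀) hγ0 hK₂0 hμ4 hC₂0 hC₃0 hC₄0 hC₅0 hiδ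
  -- the ratios and the Lipschitz ratio `M₁`
  obtain ⟨RZ, hRZ⟩ : ∃ RZ : ℝ, RZ = 4 * μ := ⟨_, rfl⟩
  obtain ⟨RV, hRV⟩ : ∃ RV : ℝ, RV = 4 * (4 ^ 2 * μ + (1 + γ) ^ 2) + (1 + γ + γ ^ 2) ^ 2 := ⟨_, rfl⟩
  have hRZ1 : 1 ≤ RZ := by rw [hRZ]; linarith
  have hRV1 : 1 ≤ RV := by rw [hRV]; nlinarith
  have hRZ0 : 0 ≤ RZ := zero_le_one.trans hRZ1
  have hRV0 : 0 ≤ RV := zero_le_one.trans hRV1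
  obtain ⟨M₁, hM₁⟩ : ∃ M₁ : ℝ, M₁ = Real.sqrt (RZ * RV) := ⟨_, rfl⟩
  have hM₁0 : 0 ≤ M₁ := by rw [hM₁]; exact Real.sqrt_nonneg _
  have hM₁sq : M₁ ^ 2 = RZ * RV := by rw [hM₁]; exact Real.sq_sqrt (mul_nonneg hRZ0 hRV0)
  have hM₁lt : M₁ < (γ ^ 2 - 3) ^ 2 := by
    have h := ratio_lt_of_mem_Icc hγ hμ0 hμr
    have e : RZ * RV = 4 * μ * (4 * (16 * μ + (1 + γ) ^ 2) + (1 + γ + γ ^ 2) ^ 2) := by rw [hRZ, hRV]; ring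
    have hr0 : 0 ≤ (γ ^ 2 - 3) ^ 2 := sq_nonneg _
    rw [hM₁, Real.sqrt_lt' (by nlinarith [hγ.1])]
    rw [e]; exact h
  obtain ⟨K₁, hK₁⟩ : ∃ K₁ : ℝ, K₁ = 2 * Real.sqrt (CA * Bz * B₂) := ⟨_, rfl⟩
  have hK₁0 : 0 ≤ K₁ := by rw [hK₁]; positivity
  refine ⟨M₁, K₁, hM₁0, hM₁lt, hK₁0, fun A => ?_⟩
  obtain ⟨ν₁, hν₁, H1A⟩ := H1 A
  refine ⟨min ν₁ 1, lt_min hν₁ one_pos, fun ν hν T' hTlt hT'1 L q hL hq hdiv hL0 hlin => ?_⟩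
  have hν0 : 0 < ν := hν.1
  have hν1 : ν ≤ 1 := hν.2.trans (min_le_right _ _)
  have hνν₁ : ν ∈ Ioc 0 ν₁ := ⟨hν.1, hν.2.trans (min_le_left _ _)⟩
  have habsν : |ν| = ν := abs_of_pos hν0
  -- the horizon
  obtain ⟨JA, hJA⟩ : ∃ JA : ℕ, JA = Jrate (γ ^ 2 - 3) ν + A := ⟨_, rfl⟩
  obtain ⟨T, hT⟩ : ∃ T : ℝ, T = DriftFree.horizon (γ ^ 2 - 3) ν A := ⟨_, rfl⟩
  have hTJ : T = CascadeParams.tStart JA := by rw [hT, hJA]; rfl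
  have hT0 : 0 ≤ T := by rw [hTJ]; exact CascadeParams.tStart_nonneg _
  have hTT' : T < T' := by rw [hT]; exact hTlt
  rw [← hT]
  have hsub0 : Icc 0 T ⊆ Icc 0 T' := Icc_subset_Icc le_rfl hTT'.le
  have hT'0 : 0 < T' := hT0.trans_lt hTT'
  -- the `L²` envelope on phase `j` up to the horizon
  have hE : ∀ j : ℕ, ∀ t ∈ Icc 0 T, t ∈ Icc (CascadeParams.tStart j) (CascadeParams.tStart (j + 1)) →
      Real.sqrt (∫ x, ‖L t x‖ ^ 2) ≤ K₂ * ν * ((j : ℝ) + 1) * μ ^ (j + 1) := by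
    intro j t ht hj
    rw [hT] at ht
    have h := H1A ν hνν₁ T' hTlt hT'1 L q hL hq hdiv hL0 hlin j t ht hj
    have h2 : K₂ * ν * ((j : ℝ) + 1) * M₂ ^ (j + 1) ≤ K₂ * ν * ((j : ℝ) + 1) * μ ^ (j + 1) :=
      mul_le_mul_of_nonneg_left (pow_le_pow_left₀ hM₂0 hM₂μ _) (by positivity)
    exact h.trans h2
  -- ### the six sizes
  obtain ⟨zf, hzf⟩ : ∃ f : ℝ → ℝ, ∀ t, f t = Real.sqrt (∫ x, torusVorticityTensor (L t) 0 1 x ^ 2) := ⟨_, fun _ => rfl⟩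
  obtain ⟨w0, hw0⟩ : ∃ f : ℝ → ℝ, ∀ t, f t =
      Real.sqrt (∫ x, (Torus.partialDeriv 0 (torusVorticityTensor (L t) 0 1) x) ^ 2) := ⟨_, fun _ => rfl⟩
  obtain ⟨w1, hw1⟩ : ∃ f : ℝ → ℝ, ∀ t, f t =
      Real.sqrt (∫ x, (Torus.partialDeriv 1 (torusVorticityTensor (L t) 0 1) x) ^ 2) := ⟨_, fun _ => rfl⟩
  obtain ⟨v00, hv00⟩ : ∃ f : ℝ → ℝ, ∀ t, f t =
      Real.sqrt (∫ x, (Torus.partialDeriv 0 (Torus.partialDeriv 0 (torusVorticityTensor (L t) 0 1)) x) ^ 2) :=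
    ⟨_, fun _ => rfl⟩
  obtain ⟨v01, hv01⟩ : ∃ f : ℝ → ℝ, ∀ t, f t =
      Real.sqrt (∫ x, (Torus.partialDeriv 0 (Torus.partialDeriv 1 (torusVorticityTensor (L t) 0 1)) x) ^ 2) :=
    ⟨_, fun _ => rfl⟩
  obtain ⟨v11, hv11⟩ : ∃ f : ℝ → ℝ, ∀ t, f t =
      Real.sqrt (∫ x, (Torus.partialDeriv 1 (Torus.partialDeriv 1 (torusVorticityTensor (L t) 0 1)) x) ^ 2) :=
    ⟨_, fun _ => rfl⟩
  have hz0' : ∀ t, 0 ≤ zf t := fun t => by rw [hzf]; exact Real.sqrt_nonneg _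
  have hw0' : ∀ t, 0 ≤ w0 t := fun t => by rw [hw0]; exact Real.sqrt_nonneg _
  have hw1' : ∀ t, 0 ≤ w1 t := fun t => by rw [hw1]; exact Real.sqrt_nonneg _
  have hv00' : ∀ t, 0 ≤ v00 t := fun t => by rw [hv00]; exact Real.sqrt_nonneg _
  have hv01' : ∀ t, 0 ≤ v01 t := fun t => by rw [hv01]; exact Real.sqrt_nonneg _
  have hv11' : ∀ t, 0 ≤ v11 t := fun t => by rw [hv11]; exact Real.sqrt_nonneg _
  have hv10 : ∀ t ∈ Icc 0 T', Real.sqrt (∫ x, (Torus.partialDeriv 1 (Torus.partialDeriv 0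
      (torusVorticityTensor (L t) 0 1)) x) ^ 2) = v01 t := by
    intro t ht
    have hω : IsSmooth (torusVorticityTensor (L t) 0 1) :=
      (isSmoothSpaceTimeOn_torusVorticityTensor hL hT'0 0 1).isSmooth_slice ht
    rw [hv01, sqrt_integral_pd_one_zero_eq hω]
  have hsN : ∀ j : ℕ, ((((⟨γ, δ₀, 2, 1, 2⟩ : CascadeParams)).N j : ℕ) : ℝ) / ((⟨γ, δ₀, 2, 1, 2⟩ : CascadeParams)).δ j = (1 / δ₀) * 4 ^ j := fun j => by
    rw [ApproxResponse.pbox_N_div_δ γ hδ₀.ne' 2 j]; norm_num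
  have hs0 : ∀ j : ℕ, (0 : ℝ) ≤ (1 / δ₀) * 4 ^ j := fun j => by positivity
  have hsd : ∀ j : ℕ, (0 : ℝ) ≤ ((((⟨γ, δ₀, 2, 1, 2⟩ : CascadeParams)).N j : ℕ) : ℝ) / ((⟨γ, δ₀, 2, 1, 2⟩ : CascadeParams)).δ j := fun j => by rw [hsN j]; positivity
  have he0 : ∀ j : ℕ, 0 ≤ (K₂ * ν * ((j : ℝ) + 1) * μ ^ (j + 1)) := fun j => by positivity
  -- ### per-slot bounds in phase form (H half-slots, from the start values)
  have hslotH : ∀ j : ℕ, CascadeParams.tStart j + CascadeParams.tHalf j ≤ T →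
      ∀ t ∈ Icc (CascadeParams.tStart j) (CascadeParams.tStart j + CascadeParams.tHalf j), ∀ (Zp Sp : ℝ),
        Zp = zf (CascadeParams.tStart j) +
          γ * ((1 / δ₀) * 4 ^ j) * (C₂ * (K₂ * ν * ((j : ℝ) + 1) * μ ^ (j + 1)) + C₃ * ν * ((1 / δ₀) * 4 ^ j)) →
        Sp = (1 + γ) * (w0 (CascadeParams.tStart j) + w1 (CascadeParams.tStart j)) +
          γ * (1 + γ) * C₂ * ((1 / δ₀) * 4 ^ j) * Zp + γ * (C₃ * ((1 / δ₀) * 4 ^ j) ^ 2 * (K₂ * ν * ((j : ℝ) + 1) * μ ^ (j + 1)) +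
            C₂ * ((1 / δ₀) * 4 ^ j) * Zp + C₄ * ν * ((1 / δ₀) * 4 ^ j) ^ 3) →
        zf t ≤ Zp ∧ w0 t + w1 t ≤ Sp ∧
        v00 t + v01 t + v11 t ≤ (1 + γ + γ ^ 2) *
            ((v00 (CascadeParams.tStart j) + v01 (CascadeParams.tStart j) + v11 (CascadeParams.tStart j)) +
              γ * C₂ * ((1 / δ₀) * 4 ^ j) * Sp + γ * (C₃ * ((1 / δ₀) * 4 ^ j) ^ 2 * Zp + C₂ * ((1 / δ₀) * 4 ^ j) * Sp) +
              γ * (C₄ * ((1 / δ₀) * 4 ^ j) ^ 3 * (K₂ * ν * ((j : ℝ) + 1) * μ ^ (j + 1)) +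
                2 * C₃ * ((1 / δ₀) * 4 ^ j) ^ 2 * Zp + C₂ * ((1 / δ₀) * 4 ^ j) * Sp + C₅ * ν * ((1 / δ₀) * 4 ^ j) ^ 4)) +
          γ * C₂ * ((1 / δ₀) * 4 ^ j) * ((w0 (CascadeParams.tStart j) + w1 (CascadeParams.tStart j)) +
            γ * C₂ * ((1 / δ₀) * 4 ^ j) * Zp) := by
    intro j hjT t ht Zp Sp eZp eSp
    have hslotT : Icc (CascadeParams.tStart j) (CascadeParams.tStart j + CascadeParams.tHalf j) ⊆ Icc 0 T := fun τ hτ => ⟨(CascadeParams.tStart_nonneg j).trans hτ.1, hτ.2.trans hjT⟩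
    have hph : ∀ τ ∈ Icc (CascadeParams.tStart j) (CascadeParams.tStart j + CascadeParams.tHalf j), τ ∈ Icc (CascadeParams.tStart j) (CascadeParams.tStart (j + 1)) := fun τ hτ =>
      ⟨hτ.1, hτ.2.trans (by rw [CascadeParams.tStart_succ]; linarith only [CascadeParams.tHalf_pos j])⟩
    have hcs := cascade_slot_H (⟨γ, δ₀, 2, 1, 2⟩ : CascadeParams) hγ1 hδ₀ (by norm_num) hν0.le (hjT.trans hTT'.le) hL hq hdiv hlin
      (κ₂ := c₃ * (((((⟨γ, δ₀, 2, 1, 2⟩ : CascadeParams)).N j : ℕ) : ℝ) / ((⟨γ, δ₀, 2, 1, 2⟩ : CascadeParams)).δ j) ^ 2) (κ₃ := c₄ * (((((⟨γ, δ₀, 2, 1, 2⟩ : CascadeParams)).N j : ℕ) : ℝ) / ((⟨γ, δ₀, 2, 1, 2⟩ : CascadeParams)).δ j) ^ 3)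
      (lam₀ := |ν| * c₃ * (((((⟨γ, δ₀, 2, 1, 2⟩ : CascadeParams)).N j : ℕ) : ℝ) / ((⟨γ, δ₀, 2, 1, 2⟩ : CascadeParams)).δ j) ^ 2)
      (lam₁ := |ν| * c₄ * (((((⟨γ, δ₀, 2, 1, 2⟩ : CascadeParams)).N j : ℕ) : ℝ) / ((⟨γ, δ₀, 2, 1, 2⟩ : CascadeParams)).δ j) ^ 3)
      (lam₂ := |ν| * c₅ * (((((⟨γ, δ₀, 2, 1, 2⟩ : CascadeParams)).N j : ℕ) : ℝ) / ((⟨γ, δ₀, 2, 1, 2⟩ : CascadeParams)).δ j) ^ 4) (e := (K₂ * ν * ((j : ℝ) + 1) * μ ^ (j + 1)))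
      (mul_nonneg hc₃ (pow_nonneg (hsd j) 2)) (mul_nonneg hc₄ (pow_nonneg (hsd j) 3))
      (mul_nonneg (mul_nonneg (abs_nonneg ν) hc₃) (pow_nonneg (hsd j) 2))
      (mul_nonneg (mul_nonneg (abs_nonneg ν) hc₄) (pow_nonneg (hsd j) 3))
      (mul_nonneg (mul_nonneg (abs_nonneg ν) hc₅) (pow_nonneg (hsd j) 4)) (he0 j)
      (fun τ hτ => (hcapH ν j τ hτ).1) (fun τ hτ => (hcapH ν j τ hτ).2.1) (fun τ hτ => (hcapH ν j τ hτ).2.2.1)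
      (fun τ hτ => (hcapH ν j τ hτ).2.2.2.1) (fun τ hτ => (hcapH ν j τ hτ).2.2.2.2)
      (fun τ hτ => hE j τ (hslotT hτ) (hph τ hτ)) ht
    simp only [hsN, habsν, ← hc₂, ← hzf, ← hw0, ← hw1, ← hv00, ← hv01, ← hv11] at hcs
    obtain ⟨h0, h1, h2⟩ := hcs
    exact natural_le_phaseForm (γ := γ) (c₂ := c₂) (c₃ := c₃) (c₄ := c₄) (c₅ := c₅) (ν := ν) (s := (1 / δ₀) * 4 ^ j)
      (e := (K₂ * ν * ((j : ℝ) + 1) * μ ^ (j + 1))) (z₀ := zf (CascadeParams.tStart j)) (S₁₀ := w0 (CascadeParams.tStart j) + w1 (CascadeParams.tStart j))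
      (S₂₀ := v00 (CascadeParams.tStart j) + v01 (CascadeParams.tStart j) + v11 (CascadeParams.tStart j)) (W₀ := w0 (CascadeParams.tStart j))
      hγ0 hc₂0 hc₃ hc₄ hc₅ hν0.le (hs0 j) (he0 j) (hz0' _) (add_nonneg (hw0' _) (hw1' _))
      (le_add_of_nonneg_right (hw1' _)) hC₂ hC₃ hC₄ hC₅ eZp eSp h0 h1 h2
  -- ### per-slot bounds in phase form (V half-slots, from the mid values)
  have hslotV : ∀ j : ℕ, CascadeParams.tStart (j + 1) ≤ T →
      ∀ t ∈ Icc (CascadeParams.tStart j + CascadeParams.tHalf j) (CascadeParams.tStart (j + 1)), ∀ (Zp Sp : ℝ),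
        Zp = zf (CascadeParams.tStart j + CascadeParams.tHalf j) +
          γ * ((1 / δ₀) * 4 ^ j) * (C₂ * (K₂ * ν * ((j : ℝ) + 1) * μ ^ (j + 1)) + C₃ * ν * ((1 / δ₀) * 4 ^ j)) →
        Sp = (1 + γ) * (w0 (CascadeParams.tStart j + CascadeParams.tHalf j) +
            w1 (CascadeParams.tStart j + CascadeParams.tHalf j)) +
          γ * (1 + γ) * C₂ * ((1 / δ₀) * 4 ^ j) * Zp + γ * (C₃ * ((1 / δ₀) * 4 ^ j) ^ 2 * (K₂ * ν * ((j : ℝ) + 1) * μ ^ (j + 1)) +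
            C₂ * ((1 / δ₀) * 4 ^ j) * Zp + C₄ * ν * ((1 / δ₀) * 4 ^ j) ^ 3) →
        zf t ≤ Zp ∧ w0 t + w1 t ≤ Sp ∧
        v00 t + v01 t + v11 t ≤ (1 + γ + γ ^ 2) *
            ((v00 (CascadeParams.tStart j + CascadeParams.tHalf j) +
                v01 (CascadeParams.tStart j + CascadeParams.tHalf j) +
                v11 (CascadeParams.tStart j + CascadeParams.tHalf j)) +
              γ * C₂ * ((1 / δ₀) * 4 ^ j) * Sp + γ * (C₃ * ((1 / δ₀) * 4 ^ j) ^ 2 * Zp + C₂ * ((1 / δ₀) * 4 ^ j) * Sp) +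
              γ * (C₄ * ((1 / δ₀) * 4 ^ j) ^ 3 * (K₂ * ν * ((j : ℝ) + 1) * μ ^ (j + 1)) +
                2 * C₃ * ((1 / δ₀) * 4 ^ j) ^ 2 * Zp + C₂ * ((1 / δ₀) * 4 ^ j) * Sp + C₅ * ν * ((1 / δ₀) * 4 ^ j) ^ 4)) +
          γ * C₂ * ((1 / δ₀) * 4 ^ j) * ((w0 (CascadeParams.tStart j + CascadeParams.tHalf j) +
              w1 (CascadeParams.tStart j + CascadeParams.tHalf j)) + γ * C₂ * ((1 / δ₀) * 4 ^ j) * Zp) := by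
    intro j hjT t ht Zp Sp eZp eSp
    have hm0 : 0 ≤ (CascadeParams.tStart j + CascadeParams.tHalf j) := add_nonneg (CascadeParams.tStart_nonneg j) (CascadeParams.tHalf_pos j).le
    have hslotT : Icc (CascadeParams.tStart j + CascadeParams.tHalf j) (CascadeParams.tStart (j + 1)) ⊆ Icc 0 T := fun τ hτ => ⟨hm0.trans hτ.1, hτ.2.trans hjT⟩
    have hslotT' : Icc (CascadeParams.tStart j + CascadeParams.tHalf j) (CascadeParams.tStart (j + 1)) ⊆ Icc 0 T' := fun τ hτ => hsub0 (hslotT hτ)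
    have hph : ∀ τ ∈ Icc (CascadeParams.tStart j + CascadeParams.tHalf j) (CascadeParams.tStart (j + 1)), τ ∈ Icc (CascadeParams.tStart j) (CascadeParams.tStart (j + 1)) := fun τ hτ =>
      ⟨le_trans (le_add_of_nonneg_right (CascadeParams.tHalf_pos j).le) hτ.1, hτ.2⟩
    have hmem : (CascadeParams.tStart j + CascadeParams.tHalf j) ∈ Icc (CascadeParams.tStart j + CascadeParams.tHalf j) (CascadeParams.tStart (j + 1)) :=
      left_mem_Icc.2 (by rw [CascadeParams.tStart_succ]; linarith only [CascadeParams.tHalf_pos j])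
    have hcs := cascade_slot_V (⟨γ, δ₀, 2, 1, 2⟩ : CascadeParams) hγ1 hδ₀ (by norm_num) hν0.le (hjT.trans hTT'.le) hL hq hdiv hlin
      (κ₂ := c₃ * (((((⟨γ, δ₀, 2, 1, 2⟩ : CascadeParams)).N j : ℕ) : ℝ) / ((⟨γ, δ₀, 2, 1, 2⟩ : CascadeParams)).δ j) ^ 2) (κ₃ := c₄ * (((((⟨γ, δ₀, 2, 1, 2⟩ : CascadeParams)).N j : ℕ) : ℝ) / ((⟨γ, δ₀, 2, 1, 2⟩ : CascadeParams)).δ j) ^ 3)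
      (lam₀ := |ν| * c₃ * (((((⟨γ, δ₀, 2, 1, 2⟩ : CascadeParams)).N j : ℕ) : ℝ) / ((⟨γ, δ₀, 2, 1, 2⟩ : CascadeParams)).δ j) ^ 2)
      (lam₁ := |ν| * c₄ * (((((⟨γ, δ₀, 2, 1, 2⟩ : CascadeParams)).N j : ℕ) : ℝ) / ((⟨γ, δ₀, 2, 1, 2⟩ : CascadeParams)).δ j) ^ 3)
      (lam₂ := |ν| * c₅ * (((((⟨γ, δ₀, 2, 1, 2⟩ : CascadeParams)).N j : ℕ) : ℝ) / ((⟨γ, δ₀, 2, 1, 2⟩ : CascadeParams)).δ j) ^ 4) (e := (K₂ * ν * ((j : ℝ) + 1) * μ ^ (j + 1)))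
      (mul_nonneg hc₃ (pow_nonneg (hsd j) 2)) (mul_nonneg hc₄ (pow_nonneg (hsd j) 3))
      (mul_nonneg (mul_nonneg (abs_nonneg ν) hc₃) (pow_nonneg (hsd j) 2))
      (mul_nonneg (mul_nonneg (abs_nonneg ν) hc₄) (pow_nonneg (hsd j) 3))
      (mul_nonneg (mul_nonneg (abs_nonneg ν) hc₅) (pow_nonneg (hsd j) 4)) (he0 j)
      (fun τ hτ => (hcapV ν j τ hτ).1) (fun τ hτ => (hcapV ν j τ hτ).2.1) (fun τ hτ => (hcapV ν j τ hτ).2.2.1)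
      (fun τ hτ => (hcapV ν j τ hτ).2.2.2.1) (fun τ hτ => (hcapV ν j τ hτ).2.2.2.2)
      (fun τ hτ => hE j τ (hslotT hτ) (hph τ hτ)) ht
    rw [hv10 t (hslotT' ht), hv10 _ (hslotT' hmem)] at hcs
    simp only [hsN, habsν, ← hc₂, ← hzf, ← hw0, ← hw1, ← hv00, ← hv11] at hcs
    obtain ⟨h0, h1, h2⟩ := hcs
    rw [add_comm (w1 (CascadeParams.tStart j + CascadeParams.tHalf j)) (w0 (CascadeParams.tStart j + CascadeParams.tHalf j))] at h1 h2
    rw [add_comm (w1 t) (w0 t)] at h1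
    have eS2 : ∀ τ, v11 τ + v01 τ + v00 τ = v00 τ + v01 τ + v11 τ := fun τ => by ring
    rw [eS2 t, eS2 (CascadeParams.tStart j + CascadeParams.tHalf j)] at h2
    exact natural_le_phaseForm (γ := γ) (c₂ := c₂) (c₃ := c₃) (c₄ := c₄) (c₅ := c₅) (ν := ν) (s := (1 / δ₀) * 4 ^ j)
      (e := (K₂ * ν * ((j : ℝ) + 1) * μ ^ (j + 1))) (z₀ := zf (CascadeParams.tStart j + CascadeParams.tHalf j)) (S₁₀ := w0 (CascadeParams.tStart j + CascadeParams.tHalf j) + w1 (CascadeParams.tStart j + CascadeParams.tHalf j))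
      (S₂₀ := v00 (CascadeParams.tStart j + CascadeParams.tHalf j) + v01 (CascadeParams.tStart j + CascadeParams.tHalf j) + v11 (CascadeParams.tStart j + CascadeParams.tHalf j)) (W₀ := w1 (CascadeParams.tStart j + CascadeParams.tHalf j))
      hγ0 hc₂0 hc₃ hc₄ hc₅ hν0.le (hs0 j) (he0 j) (hz0' _) (add_nonneg (hw0' _) (hw1' _))
      (le_add_of_nonneg_left (hw0' _)) hC₂ hC₃ hC₄ hC₅ eZp eSp h0 h1 h2
  -- the sizes vanish at `t = 0` (`L 0 = 0`)
  have hW0 : torusVorticityTensor (L 0) 0 1 = fun _ => (0 : ℝ) := by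
    funext x; rw [hL0]; simp [torusVorticityTensor, Torus.partialDeriv, Torus.lineDeriv]
  have hD0 : ∀ k : Fin 2, Torus.partialDeriv k (fun _ : UnitAddTorus (Fin 2) => (0 : ℝ)) = fun _ => (0 : ℝ) := by
    intro k; funext x; simp [Torus.partialDeriv, Torus.lineDeriv]
  have hz00 : zf 0 = 0 := by rw [hzf, hW0]; simp
  have hw00 : w0 0 = 0 := by rw [hw0, hW0, hD0]; simp
  have hw10 : w1 0 = 0 := by rw [hw1, hW0, hD0]; simp
  have hv000 : v00 0 = 0 := by rw [hv00, hW0, hD0, hD0]; simp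
  have hv010 : v01 0 = 0 := by rw [hv01, hW0, hD0, hD0]; simp
  have hv110 : v11 0 = 0 := by rw [hv11, hW0, hD0, hD0]; simp
  have hcl := hSE ν hν0 hν1 T JA hTJ zf w0 w1 v00 v01 v11 hz0' hw0' hw1' hv00' hv01' hv11' hz00 hw00 hw10
    hv000 hv010 hv110 hslotH hslotV
  -- ### the Agmon majorant `Λ = 2 √(C_A · Z · (V₀₀ + V₀₁ + V₁₁))`
  have hUD : UniqueDiffOn ℝ (Icc 0 T') := uniqueDiffOn_Icc hT'0
  have hωst := isSmoothSpaceTimeOn_torusVorticityTensor hL hT'0 (0 : Fin 2) 1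
  have hcont : ∀ {f : ℝ → UnitAddTorus (Fin 2) → ℝ}, IsSmoothSpaceTimeOn (Icc 0 T') f →
      ContinuousOn (fun t => Real.sqrt (∫ x, f t x ^ 2)) (Icc 0 T) := by
    intro f hf
    have h1 := ((hf.mul hf).continuousOn_integral (convex_Icc 0 T')).sqrt
    exact (h1.congr (fun t _ => by simp only [sq])).mono hsub0
  have hczf : ContinuousOn zf (Icc 0 T) := by
    rw [show zf = _ from funext hzf]; exact hcont hωst
  have hcv00 : ContinuousOn v00 (Icc 0 T) := by
    rw [show v00 = _ from funext hv00]; exact hcont ((hωst.partialDeriv hUD 0).partialDeriv hUD 0)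
  have hcv01 : ContinuousOn v01 (Icc 0 T) := by
    rw [show v01 = _ from funext hv01]; exact hcont ((hωst.partialDeriv hUD 1).partialDeriv hUD 0)
  have hcv11 : ContinuousOn v11 (Icc 0 T) := by
    rw [show v11 = _ from funext hv11]; exact hcont ((hωst.partialDeriv hUD 1).partialDeriv hUD 1)
  refine ⟨fun t => 2 * Real.sqrt (CA * zf t * (v00 t + v01 t + v11 t)), ?_, ?_, ?_⟩
  · exact continuousOn_const.mul (((continuousOn_const.mul hczf).mul ((hcv00.add hcv01).add hcv11)).sqrt)
  · intro t ht x
    have h := lipschitz_le_agmon_fin_two hCA0 hAg (hL.isSmooth_slice (hsub0 ht)) (hdiv t (hsub0 ht)) x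
    rw [← hzf, ← hv00, ← hv01, ← hv11] at h
    exact h
  · intro j t ht hph
    obtain ⟨h1, h2⟩ := hcl j t ht hph
    have hS0 : 0 ≤ v00 t + v01 t + v11 t := add_nonneg (add_nonneg (hv00' t) (hv01' t)) (hv11' t)
    have hX0 : 0 ≤ CA * Bz * B₂ := by positivity
    have hW0' : 0 ≤ Real.sqrt (CA * Bz * B₂) * (ν * ((j : ℝ) + 1)) * M₁ ^ (j + 1) := by positivity
    have hMp : (M₁ ^ (j + 1)) ^ 2 = (4 * μ) ^ (j + 1) * (4 * (4 ^ 2 * μ + (1 + γ) ^ 2) + (1 + γ + γ ^ 2) ^ 2) ^ (j + 1) := by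
      rw [← pow_mul', pow_mul, hM₁sq, mul_pow, hRZ, hRV]
    have hprod : CA * zf t * (v00 t + v01 t + v11 t) ≤
        (Real.sqrt (CA * Bz * B₂) * (ν * ((j : ℝ) + 1)) * M₁ ^ (j + 1)) ^ 2 := by
      have hsq : (Real.sqrt (CA * Bz * B₂) * (ν * ((j : ℝ) + 1)) * M₁ ^ (j + 1)) ^ 2 =
          CA * (Bz * (ν * ((j : ℝ) + 1)) * (4 * μ) ^ (j + 1)) *
            (B₂ * (ν * ((j : ℝ) + 1)) * (4 * (4 ^ 2 * μ + (1 + γ) ^ 2) + (1 + γ + γ ^ 2) ^ 2) ^ (j + 1)) := by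
        rw [mul_pow, mul_pow, Real.sq_sqrt hX0, hMp]; ring
      rw [hsq]
      exact mul_le_mul (mul_le_mul_of_nonneg_left h1 hCA0.le) h2 hS0 (by positivity)
    calc 2 * Real.sqrt (CA * zf t * (v00 t + v01 t + v11 t))
        ≤ 2 * Real.sqrt ((Real.sqrt (CA * Bz * B₂) * (ν * ((j : ℝ) + 1)) * M₁ ^ (j + 1)) ^ 2) := by
          gcongr
      _ = 2 * (Real.sqrt (CA * Bz * B₂) * (ν * ((j : ℝ) + 1)) * M₁ ^ (j + 1)) := by rw [Real.sqrt_sq hW0']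
      _ = K₁ * ν * ((j : ℝ) + 1) * M₁ ^ (j + 1) := by rw [hK₁]; ring

end Summit.AnomalousDissipation.AnomalousDissipation.Theorems.SawtoothPulseCascade.LipAgmon

end
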